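import Summits.BirchSwinnertonDyer.Rank1Residual.Additive.GreenbergKummerTameDescent
import Summits.BirchSwinnertonDyer.Rank1Residual.X2.GreenbergVatsalTateDatumSign
import HarnessLib

/-!
# Greenberg's local condition ASCENDS along a prime-to-`p` step: `res_{H' → H} x ∈ N.greenbergKer H`
# implies `x ∈ N.greenbergKer H'` when `[H' ⊓ I_v : H ⊓ I_v]` is prime to `p` (cell `b2b-bsdres`, team
# n1011, seat p07 (gen 5); row T-RD-M sequel (ii); the converse-direction companion of n1011-p05's
# `TameDescent.resOfLe_mem_greenbergKer` / `…_of_coprime_descent`)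

HONEST FRAMING (cell `b2b-bsdres`, run/shared/lean/b2b/bsd-rank1-residual/, verbatim in every
file): the goal of the cell is to DELETE the COMBINATION-SHAPED residual classes of the
Birch–Swinnerton-Dyer formula for ALL analytic-rank `≤ 1` elliptic curves over `ℚ` — "full BSD
formula for every rank `≤ 1` curve in class `C`" assembled STRICTLY from published theorems — so
that the rank-`≤ 1` remainder becomes exactly the CONSTRUCTION-SHAPED classes, which are TYPED
(missing-input `Prop`s), NOT attempted. This is not "finishing BSD". TOOL theorems of Galois
cohomology in the tree's `subgroupH1` / `LocalDatum.greenbergKer` model; NO definition, NO named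
fact; nothing booked; no label changes.

## What

For `E = W` over a number field `K`, a prime `p`, a place `v`, a Greenberg datum `N` at `v`, and
subgroups `H ≤ H'` of `Γ_K`:
* §1 `mem_greenbergKer_of_resOfLe_mem_of_injective` — if the restriction
  `H¹(H' ⊓ I_v, E[p^∞]/M⁺_v) → H¹(H ⊓ I_v, E[p^∞]/M⁺_v)` is injective, then Greenberg's condition for
  `res_{H' → H} x` implies it for `x` (the reverse of p05's `resOfLe_mem_greenbergKer`; pure
  functoriality `greenbergMap_H ∘ res = res ∘ greenbergMap_{H'}`).
* §2 the injectivity in the prime-to-`p` situation: `H'` CLOSED, `H = H' ⊓ U` with `U` OPEN normal and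
  `p ∤ [Γ_K : U]` (then `[H' ⊓ I_v : H ⊓ I_v] ∣ [Γ_K : U]` is prime to `p`, the quotient
  `(E[p^∞]/M⁺_v)` is `p`-primary (X2 `primary_gr`), and n1011-p05's `resOfLe_injective_of_coprime_of_isClosed` applies
  inside the compact group `D_v`): `injective_resOfLe_inertiaIn_of_index_coprime`, and the assembled
  `mem_greenbergKer_of_resOfLe_mem_of_index_coprime`, instance `…_kerSubgroup_…` (`H' = ker κ`).
* §3 consequence: the 'Kummer ⊆ Greenberg' inclusion ASCENDS — if
  `W.localKerOver p H K_v ≤ N.greenbergKer H` at the smaller group then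
  `W.localKerOver p H' K_v ≤ N.greenbergKer H'` (`resOfLe_mem_localKerOver` + §2):
  `localKerOver_le_greenbergKer_of_coprime_ascent`, `…_kerSubgroup_of_index_coprime`.
This is the step that carries the inclusion `Im κ ⊆ Greenberg` from `K·ℚ_∞` (where an additive twist
is semistable and X2's datum lemmas apply) down to `ℚ_∞` — used by
`AdditivePotMult/PotMultGreenbergKummerIdentification.lean`.

References: J.-P. Serre, *Galois Cohomology* I.§2.4–2.6 (restriction, inflation); R. Greenberg,
LNM 1716 (1999) §2, §5 p. 143; R. Greenberg 1989 §1 p. 98.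
-/

noncomputable section

open scoped Classical

namespace Summit.BirchSwinnertonDyer.Rank1Residual.GaloisImage

open NumberField IsDedekindDomain Field Literature.NumberTheory.GaloisRepresentations
  Literature.NumberTheory.EllipticCurves Literature.NumberTheory.EllipticCurves.GreenbergSelmer
  Summit.BirchSwinnertonDyer.Rank1Residual.Additive.TameDescent
  Summit.BirchSwinnertonDyer.Rank1Residual.X2

variable {K : Type} [Field K] [NumberField K] (W : WeierstrassCurve K) (p : ℕ)
variable {v : HeightOneSpectrum (𝓞 K)} (N : LocalDatum K (W.geomPrimaryTorsion p) v)
variable {H H' U : Subgroup (absoluteGaloisGroup K)}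

/-! ## §1 Ascent of Greenberg's condition, given injectivity on the inertia groups -/

/-- **Greenberg's condition ascends when restriction on the inertia groups is injective.** If
`res : H¹(H' ⊓ I_v, E[p^∞]/M⁺_v) → H¹(H ⊓ I_v, E[p^∞]/M⁺_v)` is injective, then for `x ∈ H¹(H', E[p^∞])`:
`res_{H' → H} x ∈ N.greenbergKer H ⟹ x ∈ N.greenbergKer H'` (`greenbergMap_H ∘ res = res ∘ greenbergMap_{H'}`,
n1011-p05's square). [cite: Greenberg1989, §1 p. 98 (4)] [cite: SerreGaloisCohomology1997, I.§2.4] -/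
theorem mem_greenbergKer_of_resOfLe_mem_of_injective (h : H ≤ H')
    (hinj : Function.Injective
      (resOfLe N.Gr (inertiaIn_mono (v := v) h) :
        subgroupH1 (inertiaIn H' v) N.Gr → subgroupH1 (inertiaIn H v) N.Gr))
    {x : W.subgroupH1 p H'} (hx : W.resOfLe p h x ∈ N.greenbergKer H) : x ∈ N.greenbergKer H' := by
  have key : (N.greenbergMap H).comp (W.resOfLe p h) =
      (resOfLe N.Gr (inertiaIn_mono (v := v) h)).comp (N.greenbergMap H') := by
    rw [LocalDatum.greenbergMap, LocalDatum.greenbergMap, WeierstrassCurve.resOfLe,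
      Literature.NumberTheory.EllipticCurves.resOfLe, Literature.NumberTheory.EllipticCurves.resOfLe,
      resH1Hom_comp, resH1Hom_comp]
    exact resH1Hom_congr (by ext; rfl) (by ext; rfl) _ _
  rw [LocalDatum.mem_greenbergKer_iff] at hx ⊢
  have h1 := congrArg (fun f => f x) key
  simp only [AddMonoidHom.comp_apply] at h1
  rw [hx] at h1
  exact hinj (by rw [← h1, map_zero])

/-! ## §2 The injectivity in the prime-to-`p` situation -/

omit [NumberField K] in
/-- The decomposition group `D_v` is compact (the continuous image of the compact `Γ_{K_v}`).
[cite: NeukirchANT1999, Ch. IV §1] -/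
theorem compactSpace_decomp [NumberField K] (v : HeightOneSpectrum (𝓞 K)) :
    CompactSpace (decomp (K := K) v) := by
  haveI : CompactSpace (absoluteGaloisGroup (v.adicCompletion K)) :=
    absoluteGaloisGroup_compactSpace (v.adicCompletion K)
  have hc : IsCompact ((decomp (K := K) v : Subgroup (absoluteGaloisGroup K)) :
      Set (absoluteGaloisGroup K)) := by
    have h := isCompact_range (absGaloisRestrict K (v.adicCompletion K)).continuous
    have hset : ((decomp (K := K) v : Subgroup (absoluteGaloisGroup K)) : Set (absoluteGaloisGroup K)) =
        Set.range (absGaloisRestrict K (v.adicCompletion K)) := by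
      rw [decomp, MonoidHom.coe_range]
      rfl
    rw [hset]
    exact h
  exact isCompact_iff_compactSpace.mp hc

/-- `H' ⊓ I_v` is closed in `D_v` when `H'` is closed (`I_v` is the continuous image of the closed,
hence compact, absolute inertia group of `K_v`). [cite: NeukirchANT1999, Ch. IV §1] -/
theorem isClosed_inertiaIn (hH' : IsClosed (H' : Set (absoluteGaloisGroup K))) :
    IsClosed ((inertiaIn H' v : Subgroup (decomp (K := K) v)) : Set (decomp (K := K) v)) := by
  haveI : CompactSpace (absoluteGaloisGroup (v.adicCompletion K)) :=
    absoluteGaloisGroup_compactSpace (v.adicCompletion K)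
  have hI : IsClosed ((inertia (K := K) v : Subgroup (absoluteGaloisGroup K)) :
      Set (absoluteGaloisGroup K)) := by
    have hc : IsCompact ((absInertia (v.adicCompletion K) : Subgroup
        (absoluteGaloisGroup (v.adicCompletion K))) : Set (absoluteGaloisGroup (v.adicCompletion K))) :=
      (isClosed_absInertia_holds (v.adicCompletion K)).isCompact
    have himg := hc.image (absGaloisRestrict K (v.adicCompletion K)).continuous
    have hset : ((inertia (K := K) v : Subgroup (absoluteGaloisGroup K)) : Set (absoluteGaloisGroup K)) =
        (absGaloisRestrict K (v.adicCompletion K)) '' (absInertia (v.adicCompletion K) :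
          Set (absoluteGaloisGroup (v.adicCompletion K))) := by
      ext g
      simp only [inertia, Subgroup.coe_map, Set.mem_image, SetLike.mem_coe]
      rfl
    rw [hset]
    exact himg.isClosed
  have hpre : ((inertiaIn H' v : Subgroup (decomp (K := K) v)) : Set (decomp (K := K) v)) =
      ((↑) : decomp (K := K) v → absoluteGaloisGroup K) ⁻¹'
        (((H' : Set (absoluteGaloisGroup K))) ∩ (inertia (K := K) v : Set (absoluteGaloisGroup K))) := by
    ext x
    simp only [SetLike.mem_coe, mem_inertiaIn_iff, Set.mem_preimage, Set.mem_inter_iff]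
  rw [hpre]
  exact (hH'.inter hI).preimage continuous_subtype_val

/-- `(H' ⊓ U) ⊓ I_v` is open in `H' ⊓ I_v` when `U` is open. [folklore] -/
theorem isOpen_inertiaIn_subgroupOf (hU : IsOpen (U : Set (absoluteGaloisGroup K))) :
    IsOpen (((inertiaIn (H' ⊓ U) v).subgroupOf (inertiaIn H' v) :
      Subgroup (inertiaIn H' v)) : Set (inertiaIn H' v)) := by
  have hpre : (((inertiaIn (H' ⊓ U) v).subgroupOf (inertiaIn H' v) : Subgroup (inertiaIn H' v)) :
      Set (inertiaIn H' v)) =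
      (fun x : inertiaIn H' v ↦ (((x : decomp (K := K) v)) : absoluteGaloisGroup K)) ⁻¹'
        (U : Set (absoluteGaloisGroup K)) := by
    ext x
    simp only [SetLike.mem_coe, Subgroup.mem_subgroupOf, mem_inertiaIn_iff, Subgroup.mem_inf,
      Set.mem_preimage]
    have hx := (mem_inertiaIn_iff H' v (x : decomp (K := K) v)).1 x.2
    tauto
  rw [hpre]
  exact hU.preimage (continuous_subtype_val.comp continuous_subtype_val)

/-- `(H' ⊓ U) ⊓ I_v = (H' ⊓ I_v) ⊓ U` inside `D_v`. [folklore] -/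
theorem inertiaIn_inf_eq :
    inertiaIn (H' ⊓ U) v = inertiaIn H' v ⊓ U.comap (decomp (K := K) v).subtype := by
  ext x
  simp only [mem_inertiaIn_iff, Subgroup.mem_inf, Subgroup.mem_comap, Subgroup.coe_subtype]
  tauto

/-- The index `[H' ⊓ I_v : (H' ⊓ U) ⊓ I_v]` divides `[Γ_K : U]` for `U` normal. [folklore] -/
theorem relIndex_inertiaIn_dvd_index [U.Normal] :
    (inertiaIn (H' ⊓ U) v).relIndex (inertiaIn H' v) ∣ U.index := by
  set U' : Subgroup (decomp (K := K) v) := U.comap (decomp (K := K) v).subtype with hU'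
  haveI : U'.Normal := by rw [hU']; infer_instance
  rw [inertiaIn_inf_eq, Subgroup.inf_relIndex_left]
  refine (Subgroup.relIndex_dvd_index_of_normal U' (inertiaIn H' v)).trans ?_
  rw [hU', Subgroup.index_comap, Subgroup.range_subtype]
  exact Subgroup.relIndex_dvd_index_of_normal U (decomp (K := K) v)

variable [Fact p.Prime]

/-- **Injectivity of restriction on the inertia groups in the prime-to-`p` situation**: `H'` closed,
`U` open normal with `p ∤ [Γ_K : U]`; then `H¹(H' ⊓ I_v, E[p^∞]/M⁺_v) → H¹((H' ⊓ U) ⊓ I_v, E[p^∞]/M⁺_v)`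
is injective (n1011-p05's `resOfLe_injective_of_coprime_of_isClosed` inside the compact `D_v`; the
kernel would be `[· : ·]`-torsion in a `p`-primary group). [cite: SerreGaloisCohomology1997, I.§2.4]
[cite: GreenbergLNM1716, §5 p. 143] -/
theorem injective_resOfLe_inertiaIn_of_index_coprime [U.Normal]
    (hH' : IsClosed (H' : Set (absoluteGaloisGroup K))) (hU : IsOpen (U : Set (absoluteGaloisGroup K)))
    (hcop : U.index.Coprime p) :
    Function.Injective
      (resOfLe N.Gr (inertiaIn_mono (v := v) (inf_le_left : H' ⊓ U ≤ H')) :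
        subgroupH1 (inertiaIn H' v) N.Gr → subgroupH1 (inertiaIn (H' ⊓ U) v) N.Gr) := by
  haveI : CompactSpace (decomp (K := K) v) := compactSpace_decomp v
  have hdvd := relIndex_inertiaIn_dvd_index (K := K) (v := v) (H' := H') (U := U)
  have hne : U.index ≠ 0 := by
    intro h0
    rw [h0, Nat.coprime_zero_left] at hcop
    exact (Fact.out : p.Prime).one_lt.ne' hcop
  haveI : ((inertiaIn (H' ⊓ U) v).subgroupOf (inertiaIn H' v)).FiniteIndex :=
    ⟨fun h0 ↦ hne (Nat.eq_zero_of_zero_dvd (h0 ▸ hdvd))⟩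
  exact resOfLe_injective_of_coprime_of_isClosed N.Gr _ (isOpen_inertiaIn_subgroupOf hU)
    (isClosed_inertiaIn hH') (X2.GreenbergVatsalTateDatumSign.primary_gr W p N)
    (Nat.Coprime.coprime_dvd_left hdvd hcop)

/-- **Greenberg's condition ascends from `K̄^{H' ⊓ U}` to `K̄^{H'}`** in the prime-to-`p` situation.
[cite: Greenberg1989, §1 p. 98 (4)] [cite: GreenbergLNM1716, §5 p. 143] -/
theorem mem_greenbergKer_of_resOfLe_mem_of_index_coprime [U.Normal]
    (hH' : IsClosed (H' : Set (absoluteGaloisGroup K))) (hU : IsOpen (U : Set (absoluteGaloisGroup K)))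
    (hcop : U.index.Coprime p) {x : W.subgroupH1 p H'}
    (hx : W.resOfLe p (inf_le_left : H' ⊓ U ≤ H') x ∈ N.greenbergKer (H' ⊓ U)) :
    x ∈ N.greenbergKer H' :=
  mem_greenbergKer_of_resOfLe_mem_of_injective W p N inf_le_left
    (injective_resOfLe_inertiaIn_of_index_coprime W p N hH' hU hcop) hx

/-! ## §3 The 'Kummer ⊆ Greenberg' inclusion ascends -/

/-- **`Im κ ⊆ Greenberg` ascends along a prime-to-`p` step**: if every locally-Kummer class over
`L = K̄^{H' ⊓ U}` satisfies Greenberg's condition, so does every locally-Kummer class over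
`L' = K̄^{H'}` (`U` open normal, `p ∤ [Γ_K : U]`, `H'` closed): restrict (the Kummer condition is
functorial, `resOfLe_mem_localKerOver`), apply the hypothesis, ascend (§2).
[cite: GreenbergLNM1716, §2 pp. 69–70 and §5 p. 143] -/
theorem localKerOver_le_greenbergKer_of_coprime_ascent [U.Normal]
    (hH' : IsClosed (H' : Set (absoluteGaloisGroup K))) (hU : IsOpen (U : Set (absoluteGaloisGroup K)))
    (hcop : U.index.Coprime p)
    (hK : W.localKerOver p (H' ⊓ U) (v.adicCompletion K) ≤ N.greenbergKer (H' ⊓ U)) :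
    W.localKerOver p H' (v.adicCompletion K) ≤ N.greenbergKer H' := fun _ hx ↦
  mem_greenbergKer_of_resOfLe_mem_of_index_coprime W p N hH' hU hcop
    (hK (W.resOfLe_mem_localKerOver p (v.adicCompletion K) inf_le_left hx))

/-- **The cyclotomic instance** `H' = ker κ` (`K_∞`), `U` open normal with `p ∤ [Γ_K : U]` (e.g.
`U = Gal(K̄/F)`, `F` the tame field): `Im κ ⊆ Greenberg` over `F·K_∞` gives it over `K_∞`.
[cite: GreenbergLNM1716, §2 pp. 69–70 and §5 p. 143] -/
theorem localKerOver_le_greenbergKer_kerSubgroup_of_index_coprime (κ : ZpExtension K p) [U.Normal]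
    (hU : IsOpen (U : Set (absoluteGaloisGroup K))) (hcop : U.index.Coprime p)
    (hK : W.localKerOver p (κ.kerSubgroup ⊓ U) (v.adicCompletion K) ≤ N.greenbergKer (κ.kerSubgroup ⊓ U)) :
    W.localKerOver p κ.kerSubgroup (v.adicCompletion K) ≤ N.greenbergKer κ.kerSubgroup :=
  localKerOver_le_greenbergKer_of_coprime_ascent W p N κ.isClosed_kerSubgroup hU hcop hK

end Summit.BirchSwinnertonDyer.Rank1Residual.GaloisImage

end
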